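import Mathlib.Analysis.InnerProductSpace.Projection.Reflection
import Summits.AtomisticToContinuum.Crystallization.Theorems.ExcessDecayLiouvilleHcpLiouvilleSymmetricShift

/-!
# `ExcessDecayLiouville.HcpLiouville` (stmt-AtomisticToContinuum-9332), line `Sketch` v5: the symmetric shift of uniaxial cells

Companion of `ExcessDecayLiouvilleHcpLiouvilleSymmetricShift.lean` (stub `stub_symmetricShift` of
skeleton v5 of the line `Sketch`, crux `HcpLiouville`).  That stub shows that the geometric inner shift
`A m`, `m = w₀ + √(2/3)e₃`, is an EXACT zero of the optical force of every admissible cell `A` which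
intertwines two lattice symmetries `R`, `M` of the hcp period lattice `Λ₀` (moving the motif point `m`
by lattice vectors, with only the common fixed vector `0`) with linear isometries.  Here we construct the
two generators of the hcp point group concretely and discharge the hypotheses for UNIAXIAL (in
particular CONFORMAL, `A = a·Q`, `Q` a linear isometry) cells:

* `rot₃ = σ_v ∘ σ_u`, the product of the reflections in the vertical planes orthogonal to the basal
  generators `u = (1,0,0)` and `v = (1/2, √3/2, 0)`: the 3-fold rotation about the `c`-axis,
  `(y₀,y₁,y₂) ↦ (−y₀/2 − (√3/2)y₁, (√3/2)y₀ − y₁/2, y₂)`, with `rot₃ u = v − u`, `rot₃ v = −u`,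
  `rot₃ e₃ = e₃`, `rot₃ m − m = −u`;
* `mir₃ = σ_{e₃}`, the basal mirror `(y₀,y₁,y₂) ↦ (y₀,y₁,−y₂)`, with `mir₃ m − m = −c`, `c = 2√(2/3)e₃`;
* both permute `Λ₀ = ℤu + ℤv + ℤc`, and a common fixed vector is `0` (`exists_hcp_pointGroup_generators`);
* for a UNIAXIAL cell `A = Q ∘ D`, `D = diag(s, s, s + r)` along the `c`-axis (every `c/a` ratio, basal
  scale and orientation; `D` commutes with `rot₃`, `mir₃`), the intertwiners are `T = Q ∘ rot₃ ∘ Q⁻¹`,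
  `T′ = Q ∘ mir₃ ∘ Q⁻¹`, so the optical force of a uniaxial admissible cell vanishes EXACTLY at the
  geometric shift (`hcpLiouville_symmetricShift_uniaxial`, a registered sub-goal of the item); conformal
  cells `A = a·Q` are the case `r = 0` (`hasSum_optForce_of_conformal`, `hasSum_optForce_smul_isometry`).

All `[folklore]`; a `--supports` helper for item stmt-AtomisticToContinuum-9332, nothing here closes an item.
-/

noncomputable section

namespace Summit.AtomisticToContinuum.Crystallization.Theorems.ExcessDecayLiouville

open scoped BigOperators Topology Classical InnerProductSpace RealInnerProductSpace
open Literature.MathematicalPhysics.StatisticalMechanics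
open Summit.AtomisticToContinuum.Crystallization.Theses.ExcessDecayLiouville
open Summit.AtomisticToContinuum.Crystallization.Theorems.PhononStabilityNegative

local notation "E3" => EuclideanSpace ℝ (Fin 3)

-- The 3-fold rotation about the `c`-axis: reflection in `(ℝu)ᗮ` followed by reflection in `(ℝv)ᗮ`.
local notation "rot₃" => (LinearIsometryEquiv.trans
  (Submodule.reflection (Submodule.span ℝ {(triangularVec₁ 1 : EuclideanSpace ℝ (Fin 3))})ᗮ)
  (Submodule.reflection (Submodule.span ℝ {(triangularVec₂ 1 : EuclideanSpace ℝ (Fin 3))})ᗮ))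

-- The basal mirror: reflection in the basal plane `(ℝe₃)ᗮ`.
local notation "mir₃" =>
  (Submodule.reflection (Submodule.span ℝ {(layerNormal 1 : EuclideanSpace ℝ (Fin 3))})ᗮ)

/-! ## Reflections in coordinates -/

/-- The reflection in the plane orthogonal to a unit vector `n` is `y ↦ y − 2⟪n, y⟫n`. [folklore] -/
theorem reflection_orthogonal_unit_apply {n : E3} (hn : ‖n‖ = 1) (y : E3) :
    (ℝ ∙ n)ᗮ.reflection y = y - (2 * ⟪n, y⟫) • n := by
  rw [Submodule.reflection_orthogonal_apply, Submodule.reflection_singleton_apply, hn]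
  simp only [RCLike.ofReal_real_eq_id, id_eq, one_pow, div_one, neg_sub]
  module

/-- `⟪u, y⟫ = y₀`, `⟪v, y⟫ = y₀/2 + (√3/2)y₁`, `⟪e₃, y⟫ = y₂`. [folklore] -/
theorem inner_gens_left (y : E3) :
    ⟪(triangularVec₁ 1 : E3), y⟫ = y 0 ∧ ⟪(triangularVec₂ 1 : E3), y⟫ = y 0 / 2 + √3 / 2 * y 1 ∧
      ⟪(layerNormal 1 : E3), y⟫ = y 2 := by
  refine ⟨?_, ?_, ?_⟩
  · simp [triangularVec₁, PiLp.inner_apply, Fin.sum_univ_three]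
  · simp [triangularVec₂, PiLp.inner_apply, Fin.sum_univ_three]; ring
  · simp [layerNormal, PiLp.inner_apply, Fin.sum_univ_three]

/-- `‖u‖ = ‖v‖ = ‖e₃‖ = 1`. [folklore] -/
theorem norm_gens_eq_one :
    ‖(triangularVec₁ 1 : E3)‖ = 1 ∧ ‖(triangularVec₂ 1 : E3)‖ = 1 ∧ ‖(layerNormal 1 : E3)‖ = 1 := by
  refine ⟨?_, ?_, ?_⟩
  · rw [EuclideanSpace.norm_eq]; simp [triangularVec₁, Fin.sum_univ_three]
  · rw [EuclideanSpace.norm_eq]; simp [triangularVec₂, Fin.sum_univ_three]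
    rw [div_pow, Real.sq_sqrt (by norm_num : (0 : ℝ) ≤ 3)]; norm_num
  · rw [EuclideanSpace.norm_eq]; simp [layerNormal, Fin.sum_univ_three]

/-- **The basal mirror in coordinates**: `mir₃ y = (y₀, y₁, −y₂)`. [folklore] -/
theorem mir₃_apply (y : E3) : mir₃ y 0 = y 0 ∧ mir₃ y 1 = y 1 ∧ mir₃ y 2 = -y 2 := by
  rw [reflection_orthogonal_unit_apply norm_gens_eq_one.2.2, (inner_gens_left y).2.2]
  refine ⟨?_, ?_, ?_⟩ <;> simp [layerNormal]
  ring

/-- **The 3-fold rotation in coordinates**: `rot₃ y = (−y₀/2 − (√3/2)y₁, (√3/2)y₀ − y₁/2, y₂)`. [folklore] -/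
theorem rot₃_apply (y : E3) :
    rot₃ y 0 = -(1 / 2) * y 0 - √3 / 2 * y 1 ∧ rot₃ y 1 = √3 / 2 * y 0 - 1 / 2 * y 1 ∧ rot₃ y 2 = y 2 := by
  have h3 : (√3 : ℝ) ^ 2 = 3 := Real.sq_sqrt (by norm_num)
  rw [LinearIsometryEquiv.trans_apply, reflection_orthogonal_unit_apply norm_gens_eq_one.2.1,
    reflection_orthogonal_unit_apply norm_gens_eq_one.1, (inner_gens_left _).2.1, (inner_gens_left y).1]
  refine ⟨?_, ?_, ?_⟩ <;> simp [triangularVec₁, triangularVec₂]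
  · ring
  · linear_combination (-(1 / 2) * y 1) * h3

/-! ## Action on the hcp generators and on the period lattice -/

/-- `rot₃ u = v − u`, `rot₃ v = −u`, `rot₃ (h e₃) = h e₃`. [folklore] -/
theorem rot₃_gens :
    rot₃ (triangularVec₁ 1) = triangularVec₂ 1 - triangularVec₁ 1 ∧
      rot₃ (triangularVec₂ 1) = -triangularVec₁ 1 ∧ ∀ h : ℝ, rot₃ (layerNormal h) = layerNormal h := by
  have h3 : (√3 : ℝ) ^ 2 = 3 := Real.sq_sqrt (by norm_num)
  refine ⟨?_, ?_, fun h => ?_⟩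
  · obtain ⟨h0, h1, h2⟩ := rot₃_apply (triangularVec₁ 1 : E3)
    ext i; fin_cases i
    · change rot₃ (triangularVec₁ 1) 0 = (triangularVec₂ 1 - triangularVec₁ 1 : E3) 0
      rw [h0, PiLp.sub_apply]; simp [triangularVec₁, triangularVec₂]; norm_num
    · change rot₃ (triangularVec₁ 1) 1 = (triangularVec₂ 1 - triangularVec₁ 1 : E3) 1
      rw [h1, PiLp.sub_apply]; simp [triangularVec₁, triangularVec₂]
    · change rot₃ (triangularVec₁ 1) 2 = (triangularVec₂ 1 - triangularVec₁ 1 : E3) 2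
      rw [h2, PiLp.sub_apply]; simp [triangularVec₁, triangularVec₂]
  · obtain ⟨h0, h1, h2⟩ := rot₃_apply (triangularVec₂ 1 : E3)
    ext i; fin_cases i
    · change rot₃ (triangularVec₂ 1) 0 = (-triangularVec₁ 1 : E3) 0
      rw [h0, PiLp.neg_apply]; simp [triangularVec₁, triangularVec₂]
      linear_combination (-(1 / 4)) * h3
    · change rot₃ (triangularVec₂ 1) 1 = (-triangularVec₁ 1 : E3) 1
      rw [h1, PiLp.neg_apply]; simp [triangularVec₁, triangularVec₂]; ring
    · change rot₃ (triangularVec₂ 1) 2 = (-triangularVec₁ 1 : E3) 2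
      rw [h2, PiLp.neg_apply]; simp [triangularVec₁, triangularVec₂]
  · obtain ⟨h0, h1, h2⟩ := rot₃_apply (layerNormal h : E3)
    ext i; fin_cases i
    · change rot₃ (layerNormal h) 0 = (layerNormal h : E3) 0
      rw [h0]; simp [layerNormal]
    · change rot₃ (layerNormal h) 1 = (layerNormal h : E3) 1
      rw [h1]; simp [layerNormal]
    · exact h2

/-- `mir₃ u = u`, `mir₃ v = v`, `mir₃ (h e₃) = −h e₃`. [folklore] -/
theorem mir₃_gens :
    mir₃ (triangularVec₁ 1) = triangularVec₁ 1 ∧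
      mir₃ (triangularVec₂ 1) = triangularVec₂ 1 ∧ ∀ h : ℝ, mir₃ (layerNormal h) = -layerNormal h := by
  refine ⟨?_, ?_, fun h => ?_⟩
  · refine Submodule.reflection_mem_subspace_eq_self ?_
    rw [Submodule.mem_orthogonal_singleton_iff_inner_right, (inner_gens_left _).2.2]
    simp [triangularVec₁]
  · refine Submodule.reflection_mem_subspace_eq_self ?_
    rw [Submodule.mem_orthogonal_singleton_iff_inner_right, (inner_gens_left _).2.2]
    simp [triangularVec₂]
  · refine Submodule.reflection_mem_subspace_orthogonal_precomplement_eq_neg ?_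
    refine Submodule.mem_span_singleton.2 ⟨h, ?_⟩
    ext i; fin_cases i <;> simp [layerNormal]

/-- **The 3-fold rotation permutes the period lattice**: `rot₃ (iu + jv + kc) = (−i−j)u + iv + kc`.
[folklore] -/
theorem bijOn_rot₃ : Set.BijOn rot₃ Λ₀ Λ₀ := by
  obtain ⟨hu, hv, hc⟩ := rot₃_gens
  have hmaps : Set.MapsTo rot₃ Λ₀ Λ₀ := by
    rintro z ⟨i, j, k, rfl⟩
    refine ⟨-i - j, i, k, ?_⟩
    simp only [map_add, LinearIsometryEquiv.map_smul, hu, hv, hc]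
    push_cast
    module
  refine ⟨hmaps, (LinearIsometryEquiv.injective _).injOn, ?_⟩
  rintro w ⟨i, j, k, rfl⟩
  refine ⟨(j : ℝ) • triangularVec₁ 1 + ((-i - j : ℤ) : ℝ) • triangularVec₂ 1 +
    (k : ℝ) • layerNormal (2 * Real.sqrt (2 / 3)), ⟨j, -i - j, k, rfl⟩, ?_⟩
  simp only [map_add, LinearIsometryEquiv.map_smul, hu, hv, hc]
  push_cast
  module

/-- **The basal mirror permutes the period lattice**: `mir₃ (iu + jv + kc) = iu + jv − kc`. [folklore] -/
theorem bijOn_mir₃ : Set.BijOn mir₃ Λ₀ Λ₀ := by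
  obtain ⟨hu, hv, hc⟩ := mir₃_gens
  have hmaps : Set.MapsTo mir₃ Λ₀ Λ₀ := by
    rintro z ⟨i, j, k, rfl⟩
    refine ⟨i, j, -k, ?_⟩
    simp only [map_add, LinearIsometryEquiv.map_smul, hu, hv, hc]
    push_cast
    module
  exact ⟨hmaps, (LinearIsometryEquiv.injective _).injOn, fun w hw =>
    ⟨mir₃ w, hmaps hw, Submodule.reflection_reflection _ _⟩⟩

/-- `w₀ = (u + v)/3`. [folklore] -/
theorem barlowOffset_one_eq :
    (barlowOffset 1 : E3) = (1 / 3 : ℝ) • (triangularVec₁ 1 + triangularVec₂ 1) := by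
  rw [← three_smul_barlowOffset, smul_smul]
  norm_num

/-- **The 3-fold rotation moves the motif point by a lattice vector**: `rot₃ m − m = −u`,
`m = w₀ + √(2/3)e₃`. [folklore] -/
theorem rot₃_motif_sub_mem :
    rot₃ (barlowOffset 1 + layerNormal (Real.sqrt (2 / 3))) -
      (barlowOffset 1 + layerNormal (Real.sqrt (2 / 3))) ∈ Λ₀ := by
  obtain ⟨hu, hv, hc⟩ := rot₃_gens
  refine ⟨-1, 0, 0, ?_⟩
  rw [barlowOffset_one_eq, map_add, LinearIsometryEquiv.map_smul, map_add, hu, hv, hc]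
  push_cast
  module

/-- **The basal mirror moves the motif point by a lattice vector**: `mir₃ m − m = −c`. [folklore] -/
theorem mir₃_motif_sub_mem :
    mir₃ (barlowOffset 1 + layerNormal (Real.sqrt (2 / 3))) -
      (barlowOffset 1 + layerNormal (Real.sqrt (2 / 3))) ∈ Λ₀ := by
  obtain ⟨hu, hv, hc⟩ := mir₃_gens
  have h2 : (layerNormal (2 * Real.sqrt (2 / 3)) : E3) = (2 : ℝ) • layerNormal (Real.sqrt (2 / 3)) := by
    ext i; fin_cases i <;> simp [layerNormal]
  refine ⟨0, 0, -1, ?_⟩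
  rw [barlowOffset_one_eq, map_add, LinearIsometryEquiv.map_smul, map_add, hu, hv, hc, h2]
  push_cast
  module

/-- **No common fixed vector but `0`**: `rot₃ y = y` forces `y` onto the `c`-axis, `mir₃ y = y` forces
`y` into the basal plane. [folklore] -/
theorem eq_zero_of_rot₃_of_mir₃ {y : E3} (hR : rot₃ y = y) (hM : mir₃ y = y) : y = 0 := by
  have h3 : (√3 : ℝ) ^ 2 = 3 := Real.sq_sqrt (by norm_num)
  obtain ⟨r0, r1, -⟩ := rot₃_apply y
  obtain ⟨-, -, m2⟩ := mir₃_apply y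
  rw [hR] at r0 r1
  rw [hM] at m2
  have h1 : √3 * (2 * y 0) = 0 := by linear_combination √3 * r0 - r1 + (-(1 / 2) * y 1) * h3
  have hs : (√3 : ℝ) ≠ 0 := by positivity
  have hy0 : y 0 = 0 := by
    rcases mul_eq_zero.1 h1 with h | h
    · exact absurd h hs
    · linarith
  have hy1 : y 1 = 0 := by
    rw [hy0, mul_zero, zero_sub] at r1
    linarith
  have hy2 : y 2 = 0 := by linarith
  ext i; fin_cases i
  · exact hy0
  · exact hy1
  · exact hy2

/-! ## The generators of the hcp point group -/

/-- **Generators of the hcp point group.**  There are two linear isometries `R` (the 3-fold rotation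
about the `c`-axis, `(y₀,y₁,y₂) ↦ (−y₀/2 − (√3/2)y₁, (√3/2)y₀ − y₁/2, y₂)`) and `M` (the basal mirror
`(y₀,y₁,y₂) ↦ (y₀,y₁,−y₂)`) which permute the period lattice `Λ₀`, move the motif point
`m = w₀ + √(2/3)e₃` by lattice vectors, and have no common fixed vector but `0`. [folklore] -/
theorem exists_hcp_pointGroup_generators :
    ∃ R M : E3 ≃ₗᵢ[ℝ] E3,
      Set.BijOn R Λ₀ Λ₀ ∧
      R (barlowOffset 1 + layerNormal (Real.sqrt (2 / 3))) - (barlowOffset 1 + layerNormal (Real.sqrt (2 / 3))) ∈ Λ₀ ∧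
      Set.BijOn M Λ₀ Λ₀ ∧
      M (barlowOffset 1 + layerNormal (Real.sqrt (2 / 3))) - (barlowOffset 1 + layerNormal (Real.sqrt (2 / 3))) ∈ Λ₀ ∧
      (∀ y : E3, R y = y → M y = y → y = 0) ∧
      (∀ y : E3, R y 0 = -(1 / 2) * y 0 - √3 / 2 * y 1 ∧ R y 1 = √3 / 2 * y 0 - 1 / 2 * y 1 ∧ R y 2 = y 2) ∧
      (∀ y : E3, M y 0 = y 0 ∧ M y 1 = y 1 ∧ M y 2 = -y 2) :=
  ⟨rot₃, mir₃, bijOn_rot₃, rot₃_motif_sub_mem, bijOn_mir₃, mir₃_motif_sub_mem,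
    fun _ hR hM => eq_zero_of_rot₃_of_mir₃ hR hM, rot₃_apply, mir₃_apply⟩

/-! ## Uniaxial and conformal cells -/

/-- **The optical force of a uniaxial admissible cell vanishes exactly at the geometric shift.**  If
`A = Q ∘ D` with `Q` a linear isometry and `D = diag(s, s, s + r)` uniaxial along the `c`-axis
(`D x = s·x + r·x₂·e₃`; this covers hcp cells of every `c/a` ratio and basal scale, in every
orientation), then `Σ'_{z ∈ Λ₀} F(A m + A z) = 0`, `m = w₀ + √(2/3)e₃`, `F(x) = (V′(|x|)/|x|)·x`, in
`HasSum` form: `D` commutes with `rot₃` and `mir₃`, so the intertwiners of `stub_symmetricShift` are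
`Q ∘ rot₃ ∘ Q⁻¹` and `Q ∘ mir₃ ∘ Q⁻¹`. [folklore] -/
theorem hcpLiouville_symmetricShift_uniaxial :
    ∀ (A : E3 →L[ℝ] E3) (s r : ℝ) (Q : E3 ≃ₗᵢ[ℝ] E3), Adm₀ A →
      (∀ x : E3, A x = Q (s • x + (r * x 2) • layerNormal 1)) →
      HasSum (fun z : Λ₀ =>
        (deriv lennardJones ‖A (barlowOffset 1 + layerNormal (Real.sqrt (2 / 3))) + A z‖ /
            ‖A (barlowOffset 1 + layerNormal (Real.sqrt (2 / 3))) + A z‖) •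
          (A (barlowOffset 1 + layerNormal (Real.sqrt (2 / 3))) + A z)) 0 := by
  intro A s r Q hA hAQ
  have cR : ⇑((LinearIsometryEquiv.toContinuousLinearEquiv rot₃ : E3 ≃L[ℝ] E3) : E3 →L[ℝ] E3) = ⇑rot₃ := rfl
  have cM : ⇑((LinearIsometryEquiv.toContinuousLinearEquiv mir₃ : E3 ≃L[ℝ] E3) : E3 →L[ℝ] E3) = ⇑mir₃ := rfl
  -- `D` commutes with the two generators
  have hDR : ∀ x : E3, s • rot₃ x + (r * rot₃ x 2) • (layerNormal 1 : E3) =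
      rot₃ (s • x + (r * x 2) • layerNormal 1) := by
    intro x
    rw [(rot₃_apply x).2.2, map_add, LinearIsometryEquiv.map_smul, LinearIsometryEquiv.map_smul,
      rot₃_gens.2.2]
  have hDM : ∀ x : E3, s • mir₃ x + (r * mir₃ x 2) • (layerNormal 1 : E3) =
      mir₃ (s • x + (r * x 2) • layerNormal 1) := by
    intro x
    rw [(mir₃_apply x).2.2, map_add, LinearIsometryEquiv.map_smul, LinearIsometryEquiv.map_smul,
      mir₃_gens.2.2, smul_neg, ← neg_smul, mul_neg]
  -- hence `A ∘ P = (Q ∘ P ∘ Q⁻¹) ∘ A` for both generators `P`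
  have key : ∀ P : E3 ≃ₗᵢ[ℝ] E3,
      (∀ x : E3, s • P x + (r * P x 2) • (layerNormal 1 : E3) = P (s • x + (r * x 2) • layerNormal 1)) →
        ∀ x : E3, A (P x) = ((Q.symm.trans P).trans Q) (A x) := by
    intro P hP x
    rw [hAQ, hAQ, LinearIsometryEquiv.trans_apply, LinearIsometryEquiv.trans_apply,
      LinearIsometryEquiv.symm_apply_apply, hP]
  refine stub_symmetricShift A (LinearIsometryEquiv.toContinuousLinearEquiv rot₃ : E3 ≃L[ℝ] E3)
    (LinearIsometryEquiv.toContinuousLinearEquiv mir₃ : E3 ≃L[ℝ] E3) hA ?_ ?_ ?_ ?_ ?_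
    ⟨(Q.symm.trans rot₃).trans Q, fun x => ?_⟩ ⟨(Q.symm.trans mir₃).trans Q, fun x => ?_⟩
  · rw [cR]; exact bijOn_rot₃
  · rw [cR]; exact rot₃_motif_sub_mem
  · rw [cM]; exact bijOn_mir₃
  · rw [cM]; exact mir₃_motif_sub_mem
  · rw [cR, cM]; exact fun y hR hM => eq_zero_of_rot₃_of_mir₃ hR hM
  · rw [cR]; exact key _ hDR x
  · rw [cM]; exact key _ hDM x

/-- **The optical force of a conformal admissible cell vanishes exactly at the geometric shift**:
the case `A = a·Q`, `Q` a linear isometry (`r = 0` in `hcpLiouville_symmetricShift_uniaxial`). [folklore] -/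
theorem hasSum_optForce_of_conformal {A : E3 →L[ℝ] E3} (hA : Adm₀ A) (a : ℝ) (Q : E3 ≃ₗᵢ[ℝ] E3)
    (hAQ : ∀ x : E3, A x = a • Q x) :
    HasSum (fun z : Λ₀ =>
      (deriv lennardJones ‖A (barlowOffset 1 + layerNormal (Real.sqrt (2 / 3))) + A z‖ /
          ‖A (barlowOffset 1 + layerNormal (Real.sqrt (2 / 3))) + A z‖) •
        (A (barlowOffset 1 + layerNormal (Real.sqrt (2 / 3))) + A z)) 0 :=
  hcpLiouville_symmetricShift_uniaxial A a 0 Q hA fun x => by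
    rw [zero_mul, zero_smul, add_zero, LinearIsometryEquiv.map_smul]; exact hAQ x

/-- The same for the literal conformal cell `A = a • Q`. [folklore] -/
theorem hasSum_optForce_smul_isometry (a : ℝ) (Q : E3 ≃ₗᵢ[ℝ] E3)
    (hA : Adm₀ (a • ((Q.toContinuousLinearEquiv : E3 ≃L[ℝ] E3) : E3 →L[ℝ] E3))) :
    HasSum (fun z : Λ₀ =>
      (deriv lennardJones
            ‖(a • ((Q.toContinuousLinearEquiv : E3 ≃L[ℝ] E3) : E3 →L[ℝ] E3))
                  (barlowOffset 1 + layerNormal (Real.sqrt (2 / 3))) +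
                (a • ((Q.toContinuousLinearEquiv : E3 ≃L[ℝ] E3) : E3 →L[ℝ] E3)) z‖ /
          ‖(a • ((Q.toContinuousLinearEquiv : E3 ≃L[ℝ] E3) : E3 →L[ℝ] E3))
                (barlowOffset 1 + layerNormal (Real.sqrt (2 / 3))) +
              (a • ((Q.toContinuousLinearEquiv : E3 ≃L[ℝ] E3) : E3 →L[ℝ] E3)) z‖) •
        ((a • ((Q.toContinuousLinearEquiv : E3 ≃L[ℝ] E3) : E3 →L[ℝ] E3))
            (barlowOffset 1 + layerNormal (Real.sqrt (2 / 3))) +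
          (a • ((Q.toContinuousLinearEquiv : E3 ≃L[ℝ] E3) : E3 →L[ℝ] E3)) z)) 0 :=
  hasSum_optForce_of_conformal hA a Q fun _ => rfl

end Summit.AtomisticToContinuum.Crystallization.Theorems.ExcessDecayLiouville
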